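import Mathlib
import Summits.FinalStateConjecture.FinalStateConjecture.Theses.TwoBoundarySqueeze
import Literature.Geometry.Lorentzian.TameGenericityLocal

/-!
# Birth skeleton of piece X₂ `ThresholdTransversality` (Sub₂ of line `censored-curves-split`, crux
# `GenericCensorshipThirdLaw`, stmt-FinalStateConjecture-17297; = stub `stub_thresholdTransversal`, shared
# verbatim with the sibling crux `GenericCensoredCapture`) — BC3 "a plan for the piece" (v2 texts)

`ThresholdTransversality_of : stub_thresholdWall → stub_censoredNearThreshold → ThresholdTransversality`
(conclusion = verbatim the piece's registered text).

* `stub_thresholdWall` — THE EXTREMAL STRATUM IS A WALL AT CENSORED DATA (third law only): through every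
  censored admissible datum with an extremal honest `C⁰` endpoint passes a tame immersed injective admissible
  curve whose members with `0 < ‖c‖ < ε` satisfy the C⁰ third law (no censorship claim on the members).
  Model theorem: Angelopoulos–Kehle–Unger (arXiv:2603.10378 Thm 2; arXiv:2410.16234): the asymptotically
  extremal set is a `C¹` hypersurface and the final parameter ratio a `C¹` submersion (EMSF, spherical
  symmetry) — one transverse compactly supported kick leaves it. [size: open-problem in vacuum]
* `stub_censoredNearThreshold` — CENSORSHIP IS RECOVERED OFF THE WALL: given such a third-law-good tame
  curve through a censored datum with an extremal honest endpoint, a tame immersed injective admissible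
  curve through the same datum whose members with `0 < ‖c‖ < ε'` are GOOD (censored AND third-law good;
  both sides of the Kehle–Unger threshold are censored — dispersion / sub-extremal collapse,
  arXiv:2402.10190; the naked stratum does not pass through a censored threshold datum along every tilt).
  [size: open-problem]

Composition: chain the two (the second is handed the first's curve); sorries only in the two stubs. BC3
probes (`stub → piece`, `stub → FinalStateConjecture`, `exact?`/`aesop`): all fail (strategist folder
`bc/v2_X2_birth_probe.lean`).
-/

set_option linter.dupNamespace false

noncomputable section

open scoped Manifold ContDiff Topology
open Set Function Filter

namespace Summit.FinalStateConjecture.FinalStateConjecture.Cruxes.GenericCensorshipThirdLaw.CensoredCurvesSplit.BirthX2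

/-- **Stub A `stub_thresholdWall`** — escape from the extremal stratum at censored data, third law only.
[cite: AngelopoulosKehleUnger2026, Thm. 2] -/
theorem stub_thresholdWall :
    ∀ (X : Type) [TopologicalSpace X] [ChartedSpace Literature.Geometry.Lorentzian.E3 X] [IsManifold (𝓡 3) (⊤ : ℕ∞) X] [T2Space X] [SecondCountableTopology X] [ConnectedSpace X], ∀ D ∈ Literature.Geometry.Lorentzian.admissibleVacuumData X, (∀ 𝒟 : Literature.Geometry.Lorentzian.VacuumCauchyDevelopment (D), 𝒟.IsMaximal → Summit.FinalStateConjecture.HasCompleteNullInfinity 𝒟.toCauchyDevelopment) → (∃ 𝒟 : Literature.Geometry.Lorentzian.VacuumCauchyDevelopment (D), 𝒟.IsMaximal ∧ ∃ (O : Set 𝒟.carrier) (d₀ : Literature.Geometry.Lorentzian.FinalStateDecomposition 𝒟.toSpacetime O 0), O = Summit.FinalStateConjecture.exteriorOf 𝒟.toCauchyDevelopment d₀.charted ∧ Summit.FinalStateConjecture.RaysStayInClosure 𝒟.toCauchyDevelopment O ∧ Summit.FinalStateConjecture.HasExhaustiveCharts d₀ ∧ Summit.FinalStateConjecture.IsFutureOriented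 d₀ ∧ ∃ i, ¬ Literature.Geometry.Lorentzian.Kerr.IsSubextremal (d₀.mass i) (d₀.spin i)) → ∃ (e : Literature.Geometry.Lorentzian.AFEnd X) (F : (EuclideanSpace ℝ (Fin 1) → Literature.Geometry.Lorentzian.InitialDataSet (𝓡 3) X)), Literature.Geometry.Lorentzian.InitialDataSet.IsTameDataFamily e 1 F ∧ Literature.Geometry.Lorentzian.InitialDataSet.IsImmersedAtZero 1 F ∧ F 0 = D ∧ Function.Injective F ∧ (∀ c, F c ∈ Literature.Geometry.Lorentzian.admissibleVacuumData X) ∧ ∃ ε > (0 : ℝ), ∀ c, c ≠ 0 → ‖c‖ < ε → (∀ 𝒟 : Literature.Geometry.Lorentzian.VacuumCauchyDevelopment (F c), 𝒟.IsMaximal → ∀ (O : Set 𝒟.carrier) (d : Literature.Geometry.Lorentzian.FinalStateDecomposition 𝒟.toSpacetime O 0), O = Summit.FinalStateConjecture.exteriorOf 𝒟.toCauchyDevelopment d.charted → Summit.FinalStateConjecture.RaysStayInClosure 𝒟.toCauchyDevelopment O → Summit.FinalStateConjecture.HasExhaustiveCharts d → Summit.FinalStateConjecture.IsFutureOriented d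 → ∀ i, Literature.Geometry.Lorentzian.Kerr.IsSubextremal (d.mass i) (d.spin i)) := by
  sorry

/-- **Stub B `stub_censoredNearThreshold`** — censorship recovered along/near a third-law-good tame curve
through a censored datum with an extremal honest endpoint. [cite: KehleUnger2024, Thm. 1] -/
theorem stub_censoredNearThreshold :
    ∀ (X : Type) [TopologicalSpace X] [ChartedSpace Literature.Geometry.Lorentzian.E3 X] [IsManifold (𝓡 3) (⊤ : ℕ∞) X] [T2Space X] [SecondCountableTopology X] [ConnectedSpace X], ∀ (e : Literature.Geometry.Lorentzian.AFEnd X) (F : (EuclideanSpace ℝ (Fin 1) → Literature.Geometry.Lorentzian.InitialDataSet (𝓡 3) X)) (ε : ℝ), Literature.Geometry.Lorentzian.InitialDataSet.IsTameDataFamily e 1 F → Literature.Geometry.Lorentzian.InitialDataSet.IsImmersedAtZero 1 F → Function.Injective F → (∀ c, F c ∈ Literature.Geometry.Lorentzian.admissibleVacuumData X) → (∀ 𝒟 : Literature.Geometry.Lorentzian.VacuumCauchyDevelopment (F 0), 𝒟.IsMaximal → Summit.FinalStateConjecture.HasCompleteNullInfinity 𝒟.toCauchyDevelopment) → (∃ 𝒟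 : Literature.Geometry.Lorentzian.VacuumCauchyDevelopment (F 0), 𝒟.IsMaximal ∧ ∃ (O : Set 𝒟.carrier) (d₀ : Literature.Geometry.Lorentzian.FinalStateDecomposition 𝒟.toSpacetime O 0), O = Summit.FinalStateConjecture.exteriorOf 𝒟.toCauchyDevelopment d₀.charted ∧ Summit.FinalStateConjecture.RaysStayInClosure 𝒟.toCauchyDevelopment O ∧ Summit.FinalStateConjecture.HasExhaustiveCharts d₀ ∧ Summit.FinalStateConjecture.IsFutureOriented d₀ ∧ ∃ i, ¬ Literature.Geometry.Lorentzian.Kerr.IsSubextremal (d₀.mass i) (d₀.spin i)) → 0 < ε → (∀ c, c ≠ 0 → ‖c‖ < ε → (∀ 𝒟 : Literature.Geometry.Lorentzian.VacuumCauchyDevelopment (F c), 𝒟.IsMaximal → ∀ (O : Set 𝒟.carrier) (d : Literature.Geometry.Lorentzian.FinalStateDecomposition 𝒟.toSpacetime O 0), O = Summit.FinalStateConjecture.exteriorOf 𝒟.toCauchyDevelopment d.charted → Summit.FinalStateConjecture.RaysStayInClosure 𝒟.toCauchyDevelopment O → Summit.FinalStateConjecture.HasExhaustiveCharts d → Summit.FinalStateConjecture.IsFutureOriented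 d → ∀ i, Literature.Geometry.Lorentzian.Kerr.IsSubextremal (d.mass i) (d.spin i))) → ∃ (e' : Literature.Geometry.Lorentzian.AFEnd X) (F' : (EuclideanSpace ℝ (Fin 1) → Literature.Geometry.Lorentzian.InitialDataSet (𝓡 3) X)), Literature.Geometry.Lorentzian.InitialDataSet.IsTameDataFamily e' 1 F' ∧ Literature.Geometry.Lorentzian.InitialDataSet.IsImmersedAtZero 1 F' ∧ F' 0 = F 0 ∧ Function.Injective F' ∧ (∀ c, F' c ∈ Literature.Geometry.Lorentzian.admissibleVacuumData X) ∧ ∃ ε > (0 : ℝ), ∀ c, c ≠ 0 → ‖c‖ < ε → ∀ 𝒟 : Literature.Geometry.Lorentzian.VacuumCauchyDevelopment (F' c), 𝒟.IsMaximal → Summit.FinalStateConjecture.HasCompleteNullInfinity 𝒟.toCauchyDevelopment ∧ ∀ (O : Set 𝒟.carrier) (d : Literature.Geometry.Lorentzian.FinalStateDecomposition 𝒟.toSpacetime O 0), O = Summit.FinalStateConjecture.exteriorOf 𝒟.toCauchyDevelopment d.charted → Summit.FinalStateConjecture.RaysStayInClosure 𝒟.toCauchyDevelopment O → Summit.FinalStateConjecture.HasExhaustiveCharts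 d → Summit.FinalStateConjecture.IsFutureOriented d → ∀ i, Literature.Geometry.Lorentzian.Kerr.IsSubextremal (d.mass i) (d.spin i) := by
  sorry

/-- **X₂ from the two stubs** (conclusion verbatim the registered piece `ThresholdTransversality` =
`stub_thresholdTransversal`). [folklore] -/
theorem ThresholdTransversality_of
    (hA : ∀ (X : Type) [TopologicalSpace X] [ChartedSpace Literature.Geometry.Lorentzian.E3 X] [IsManifold (𝓡 3) (⊤ : ℕ∞) X] [T2Space X] [SecondCountableTopology X] [ConnectedSpace X], ∀ D ∈ Literature.Geometry.Lorentzian.admissibleVacuumData X, (∀ 𝒟 : Literature.Geometry.Lorentzian.VacuumCauchyDevelopment (D), 𝒟.IsMaximal → Summit.FinalStateConjecture.HasCompleteNullInfinity 𝒟.toCauchyDevelopment) → (∃ 𝒟 : Literature.Geometry.Lorentzian.VacuumCauchyDevelopment (D), 𝒟.IsMaximal ∧ ∃ (O : Set 𝒟.carrier) (d₀ : Literature.Geometry.Lorentzian.FinalStateDecomposition 𝒟.toSpacetime O 0), O = Summit.FinalStateConjecture.exteriorOf 𝒟.toCauchyDevelopment d₀.charted ∧ Summit.FinalStateConjecture.RaysStayInClosure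 𝒟.toCauchyDevelopment O ∧ Summit.FinalStateConjecture.HasExhaustiveCharts d₀ ∧ Summit.FinalStateConjecture.IsFutureOriented d₀ ∧ ∃ i, ¬ Literature.Geometry.Lorentzian.Kerr.IsSubextremal (d₀.mass i) (d₀.spin i)) → ∃ (e : Literature.Geometry.Lorentzian.AFEnd X) (F : (EuclideanSpace ℝ (Fin 1) → Literature.Geometry.Lorentzian.InitialDataSet (𝓡 3) X)), Literature.Geometry.Lorentzian.InitialDataSet.IsTameDataFamily e 1 F ∧ Literature.Geometry.Lorentzian.InitialDataSet.IsImmersedAtZero 1 F ∧ F 0 = D ∧ Function.Injective F ∧ (∀ c, F c ∈ Literature.Geometry.Lorentzian.admissibleVacuumData X) ∧ ∃ ε > (0 : ℝ), ∀ c, c ≠ 0 → ‖c‖ < ε → (∀ 𝒟 : Literature.Geometry.Lorentzian.VacuumCauchyDevelopment (F c), 𝒟.IsMaximal → ∀ (O : Set 𝒟.carrier) (d : Literature.Geometry.Lorentzian.FinalStateDecomposition 𝒟.toSpacetime O 0), O = Summit.FinalStateConjecture.exteriorOf 𝒟.toCauchyDevelopment d.charted → Summit.FinalStateConjecture.RaysStayInClosure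 𝒟.toCauchyDevelopment O → Summit.FinalStateConjecture.HasExhaustiveCharts d → Summit.FinalStateConjecture.IsFutureOriented d → ∀ i, Literature.Geometry.Lorentzian.Kerr.IsSubextremal (d.mass i) (d.spin i)))
    (hB : ∀ (X : Type) [TopologicalSpace X] [ChartedSpace Literature.Geometry.Lorentzian.E3 X] [IsManifold (𝓡 3) (⊤ : ℕ∞) X] [T2Space X] [SecondCountableTopology X] [ConnectedSpace X], ∀ (e : Literature.Geometry.Lorentzian.AFEnd X) (F : (EuclideanSpace ℝ (Fin 1) → Literature.Geometry.Lorentzian.InitialDataSet (𝓡 3) X)) (ε : ℝ), Literature.Geometry.Lorentzian.InitialDataSet.IsTameDataFamily e 1 F → Literature.Geometry.Lorentzian.InitialDataSet.IsImmersedAtZero 1 F → Function.Injective F → (∀ c, F c ∈ Literature.Geometry.Lorentzian.admissibleVacuumData X) → (∀ 𝒟 : Literature.Geometry.Lorentzian.VacuumCauchyDevelopment (F 0), 𝒟.IsMaximal → Summit.FinalStateConjecture.HasCompleteNullInfinity 𝒟.toCauchyDevelopment) → (∃ 𝒟 : Literature.Geometry.Lorentzian.VacuumCauchyDevelopment (F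 0), 𝒟.IsMaximal ∧ ∃ (O : Set 𝒟.carrier) (d₀ : Literature.Geometry.Lorentzian.FinalStateDecomposition 𝒟.toSpacetime O 0), O = Summit.FinalStateConjecture.exteriorOf 𝒟.toCauchyDevelopment d₀.charted ∧ Summit.FinalStateConjecture.RaysStayInClosure 𝒟.toCauchyDevelopment O ∧ Summit.FinalStateConjecture.HasExhaustiveCharts d₀ ∧ Summit.FinalStateConjecture.IsFutureOriented d₀ ∧ ∃ i, ¬ Literature.Geometry.Lorentzian.Kerr.IsSubextremal (d₀.mass i) (d₀.spin i)) → 0 < ε → (∀ c, c ≠ 0 → ‖c‖ < ε → (∀ 𝒟 : Literature.Geometry.Lorentzian.VacuumCauchyDevelopment (F c), 𝒟.IsMaximal → ∀ (O : Set 𝒟.carrier) (d : Literature.Geometry.Lorentzian.FinalStateDecomposition 𝒟.toSpacetime O 0), O = Summit.FinalStateConjecture.exteriorOf 𝒟.toCauchyDevelopment d.charted → Summit.FinalStateConjecture.RaysStayInClosure 𝒟.toCauchyDevelopment O → Summit.FinalStateConjecture.HasExhaustiveCharts d → Summit.FinalStateConjecture.IsFutureOriented d → ∀ i, Literature.Geometry.Lorentzian.Kerr.IsSubextremal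 (d.mass i) (d.spin i))) → ∃ (e' : Literature.Geometry.Lorentzian.AFEnd X) (F' : (EuclideanSpace ℝ (Fin 1) → Literature.Geometry.Lorentzian.InitialDataSet (𝓡 3) X)), Literature.Geometry.Lorentzian.InitialDataSet.IsTameDataFamily e' 1 F' ∧ Literature.Geometry.Lorentzian.InitialDataSet.IsImmersedAtZero 1 F' ∧ F' 0 = F 0 ∧ Function.Injective F' ∧ (∀ c, F' c ∈ Literature.Geometry.Lorentzian.admissibleVacuumData X) ∧ ∃ ε > (0 : ℝ), ∀ c, c ≠ 0 → ‖c‖ < ε → ∀ 𝒟 : Literature.Geometry.Lorentzian.VacuumCauchyDevelopment (F' c), 𝒟.IsMaximal → Summit.FinalStateConjecture.HasCompleteNullInfinity 𝒟.toCauchyDevelopment ∧ ∀ (O : Set 𝒟.carrier) (d : Literature.Geometry.Lorentzian.FinalStateDecomposition 𝒟.toSpacetime O 0), O = Summit.FinalStateConjecture.exteriorOf 𝒟.toCauchyDevelopment d.charted → Summit.FinalStateConjecture.RaysStayInClosure 𝒟.toCauchyDevelopment O → Summit.FinalStateConjecture.HasExhaustiveCharts d → Summit.FinalStateConjecture.IsFutureOriented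 d → ∀ i, Literature.Geometry.Lorentzian.Kerr.IsSubextremal (d.mass i) (d.spin i)) :
    ∀ (X : Type) [TopologicalSpace X] [ChartedSpace Literature.Geometry.Lorentzian.E3 X] [IsManifold (𝓡 3) (⊤ : ℕ∞) X] [T2Space X] [SecondCountableTopology X] [ConnectedSpace X], ∀ D ∈ Literature.Geometry.Lorentzian.admissibleVacuumData X, (∀ 𝒟 : Literature.Geometry.Lorentzian.VacuumCauchyDevelopment D, 𝒟.IsMaximal → Summit.FinalStateConjecture.HasCompleteNullInfinity 𝒟.toCauchyDevelopment) → (∃ 𝒟 : Literature.Geometry.Lorentzian.VacuumCauchyDevelopment D, 𝒟.IsMaximal ∧ ∃ (O : Set 𝒟.carrier) (d₀ : Literature.Geometry.Lorentzian.FinalStateDecomposition 𝒟.toSpacetime O 0), O = Summit.FinalStateConjecture.exteriorOf 𝒟.toCauchyDevelopment d₀.charted ∧ Summit.FinalStateConjecture.RaysStayInClosure 𝒟.toCauchyDevelopment O ∧ Summit.FinalStateConjecture.HasExhaustiveCharts d₀ ∧ Summit.FinalStateConjecture.IsFutureOriented d₀ ∧ ∃ i, ¬ Literature.Geometry.Lorentzian.Kerr.IsSubextremal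 (d₀.mass i) (d₀.spin i)) → ∃ (e : Literature.Geometry.Lorentzian.AFEnd X) (F : EuclideanSpace ℝ (Fin 1) → Literature.Geometry.Lorentzian.InitialDataSet (𝓡 3) X), Literature.Geometry.Lorentzian.InitialDataSet.IsTameDataFamily e 1 F ∧ Literature.Geometry.Lorentzian.InitialDataSet.IsImmersedAtZero 1 F ∧ F 0 = D ∧ Function.Injective F ∧ (∀ c, F c ∈ Literature.Geometry.Lorentzian.admissibleVacuumData X) ∧ ∃ ε > (0 : ℝ), ∀ c, c ≠ 0 → ‖c‖ < ε → ∀ 𝒟 : Literature.Geometry.Lorentzian.VacuumCauchyDevelopment (F c), 𝒟.IsMaximal → Summit.FinalStateConjecture.HasCompleteNullInfinity 𝒟.toCauchyDevelopment ∧ ∀ (O : Set 𝒟.carrier) (d : Literature.Geometry.Lorentzian.FinalStateDecomposition 𝒟.toSpacetime O 0), O = Summit.FinalStateConjecture.exteriorOf 𝒟.toCauchyDevelopment d.charted → Summit.FinalStateConjecture.RaysStayInClosure 𝒟.toCauchyDevelopment O → Summit.FinalStateConjecture.HasExhaustiveCharts d → Summit.FinalStateConjecture.IsFutureOriented d → ∀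 i, Literature.Geometry.Lorentzian.Kerr.IsSubextremal (d.mass i) (d.spin i) := by
  intro X _ _ _ _ _ _ D hD hC hT
  obtain ⟨e, F, hF, himm, h0, hinj, h𝓓, ε, hε, hthird⟩ := hA X D hD hC hT
  subst h0
  exact hB X e F ε hF himm hinj h𝓓 hC hT hε hthird

end Summit.FinalStateConjecture.FinalStateConjecture.Cruxes.GenericCensorshipThirdLaw.CensoredCurvesSplit.BirthX2

end
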